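import Summits.ResolutionOfSingularities.ResolutionOfSingularities.Theorems.PurelyInseparableDim4ChartChainShape
import HarnessLib

/-!
# Purely inseparable four-folds `z^p + F(x₁, …, x₄)`: MONOTONE COORDINATE CHAINS ARE MULTIPLE BLOW-UPS,
# UNCONDITIONALLY (brick TY-2 (h) part 6b of cell `res-dim4-pi`)

[OURS · counted 0] (D-0157 DOOR 2; director-resolution DR-157-C; frame `PIDim4.TerminationImpliesOrderReduction`,
S3 (c)). Sequel of `PurelyInseparableDim4ChartChainShape.lean`; the last piece of the «chart chain» for
coordinate centres. A branch of the cell's walk `(F, 0, ∅) = s₀ → s₁ → s₂ → …` along coordinate centres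
`S₀, S₁, S₂, …` (charts `j_k ∈ S_k`, points `b_k`) is FULLY MONOTONE if `S₀ ⊆ S₁ ⊆ S₂ ⊆ …`: each centre lies in
ALL the new exceptional divisors and in the strict transforms of the previous centre's hyperplanes (the shape of a
walk following sections over an equimultiple locus of constant dimension). PROVED here (no `sorry`, no new
axiom), with NO hypothesis beyond the walk's own data (Hironaka-permissibility of each centre for the current
state):

* **`monotone_chain_start`** — depth 1: for `S₀` permissible for `z^p + F`, ANY blowing up `π : W → 𝔸⁵` along
  `V(z, x_{S₀})`, `j ∈ S₀`, `b_j = 0`: `IsMultipleBlowup M₀ π M₁`, `HasSNC M₁.boundary`, a re-centred chart `φ` on which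
  `M₁` reads `(z^p + s₁.F)·𝒪`, and for EVERY `S₁ ⊇ S₀`: `φ(V(z, x_{S₁}))` is closed and the boundary `[E]` has the
  SHAPE relative to `(φ, S₁)` — the INVARIANT of the induction;
* **`monotone_chain_step`** — INVARIANT(Z, φ, M, s, S) [multiple blow-up so far, `HasSNC`, chart reading
  `(z^p + s.F)·𝒪`, closed chart centre, boundary SHAPE] and `p ≤ ord_{(x_S)} s.F` ⇒ for ANY blowing up `π₂` along
  the global centre `Z_c` and every `j ∈ S`, `b` (`b_j = 0`): `IsMultipleBlowup M₀ (π₂ ≫ σ) M₂`, `HasSNC M₂.boundary`,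
  and a chart `φ''` with INVARIANT(W₂, φ'', M₂, step p S j b s, S'') for EVERY `S'' ⊇ S` — the boundary's simple
  normal crossings with the next centre (desk caveat FC-1) being DERIVED from the shape
  (`hasSNCWith_globalCentre_of_shape`), not assumed.

Iterating: `monotone_chain_start` gives INVARIANT at depth 1 for every `S₁ ⊇ S₀`; each `monotone_chain_step` consumes
INVARIANT(…, S_k) with the walk's permissibility `p ≤ ord_{(x_{S_k})} s_k.F` and returns `IsMultipleBlowup` one level
deeper together with INVARIANT(…, S_{k+1}) for every `S_{k+1} ⊇ S_k` — so every finite fully monotone branch of the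
walk, read through ANY choices of the blowings up, is an `IsMultipleBlowup` of `(𝔸⁵, (z^p + F)·𝒪, [], p)` whose last
transform reads `(z^p + s_n.F)·𝒪` on a chart (and is a marked RESOLUTION as soon as that transform has empty
support, e.g. by typ-3's stop condition `support_transform_eq_empty_iff`).

Scope, honestly: only FULLY monotone branches (`S_k ⊆ S_{k+1}`); `S_k.erase j_k ⊆ S_{k+1}` suffices for the
globalisation of the centre (`coord_chain_step`) but then a translated old hyperplane `V(x_{j_k} + c)` may meet
the next centre and the snc input is again FC-1's; branches with `S_k.erase j_k ⊄ S_{k+1}` ESCAPE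
(`isClosed_image_CΛ_chart_iff`). Nothing here is a statement about resolution of singularities in dimension ≥ 4 /
characteristic `p` (NOT proved anywhere in this programme). bears_on: LADDER-RESOLUTION:D157-DOOR2 (res-dim4-pi).
Supports stmt-ResolutionOfSingularities-16155 (helper, TY-2 (h)).
-/

-- every declaration of this summit lives under `Summit.ResolutionOfSingularities.ResolutionOfSingularities`
-- (summit = problem), which the duplicate-namespace linter flags; house convention (cf. the Target file).
set_option linter.dupNamespace false

noncomputable section

open MvPolynomial Finset CategoryTheory AlgebraicGeometry Opposite TopologicalSpace
open AlgebraicGeometry.Scheme.IdealSheafData (ofIdealTop vanishingIdeal)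

namespace Summit.ResolutionOfSingularities.ResolutionOfSingularities.Theorems.PIDim4

open Literature.AlgebraicGeometry.Resolution
open Literature.AlgebraicGeometry.Resolution.AffinePointBlowup (P A γ coord Wtop)

namespace ChartDictionary

section Monotone

variable {K : Type} [Field K] {p : ℕ} [Fact p.Prime] [CharP K p] [PerfectRing K p] [DecidableEq K]
  {X₀ Z W₂ : Scheme.{0}} (φ : P 4 K ⟶ Z) [IsOpenImmersion φ] {π₂ : W₂ ⟶ Z} {S' : Finset (Fin 4)} {j' : Fin 4}

/-- **THE UNCONDITIONAL STEP OF A FULLY MONOTONE COORDINATE CHAIN.** From INVARIANT(Z, φ, M, s₁, S') — a multiple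
blow-up `M₀ ⇝ M` with `HasSNC M.boundary`, a chart `φ : 𝔸⁵_K ⟶ Z` on which `M` (multiplicity `p`) reads
`(z^p + s₁.F)·𝒪`, `φ(V(z, x_{S'}))` CLOSED in `Z`, and the boundary SHAPE relative to `(φ, S')` — together with
`p ≤ ord_{(x_{S'})} s₁.F`: for ANY blowing up `π₂` along the global centre `Z_c` and every `j' ∈ S'`, `b'` (`b'_{j'} = 0`),
`IsMultipleBlowup M₀ (π₂ ≫ σ) M₂` and `HasSNC M₂.boundary` (`M₂ = M.transform π₂ Z_c`), and a re-centred chart of the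
chart `φ''` with `M₂|_{φ''} = (z^p + (step p S' j' b' s₁).F)·𝒪` such that INVARIANT(W₂, φ'', M₂, step p S' j' b' s₁, S'')
holds for EVERY `S'' ⊇ S'` (closedness AND shape). No simple-normal-crossings hypothesis: it is derived from the shape. -/
theorem monotone_chain_step [IsLocallyNoetherian Z] {M₀ : MarkedIdeal X₀} {σ : Z ⟶ X₀} {M : MarkedIdeal Z}
    (hσ : IsMultipleBlowup M₀ σ M) (hE : HasSNC M.boundary) (hmult : M.mult = p) (s₁ : State K)
    (hM : M.ideal.comap φ = hypSheaf p s₁.F)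
    (hperm' : (p : ℕ∞) ≤ CentreBlowup.ordAlong S' s₁.F)
    (hT : IsClosed (φ '' (AffineCoordBlowup.CΛ 4 K (insert 0 (Fin.succ '' (S' : Set (Fin 4)))) : Set (P 4 K))))
    (hshape : ∀ D ∈ M.boundary, (∃ i ∈ S', D.comap φ = ofIdealTop (Ideal.span {coord 4 K i.succ})) ∨
      ((D.support : Set Z) ∩ φ '' (AffineCoordBlowup.CΛ 4 K (insert 0 (Fin.succ '' (S' : Set (Fin 4)))) : Set (P 4 K)) = ∅))
    (hπ₂ : IsBlowup π₂ (vanishingIdeal (closureImage φ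
      ((AffineCoordBlowup.𝓘Λ 4 K (insert 0 (Fin.succ '' (S' : Set (Fin 4))))).support : Set (P 4 K)))))
    (hj' : j' ∈ S') {b' : Fin 4 → K} (hbj' : b' j' = 0) :
    IsMultipleBlowup M₀ (π₂ ≫ σ) (M.transform π₂ (vanishingIdeal (closureImage φ
        ((AffineCoordBlowup.𝓘Λ 4 K (insert 0 (Fin.succ '' (S' : Set (Fin 4))))).support : Set (P 4 K))))) ∧
      HasSNC (M.transform π₂ (vanishingIdeal (closureImage φ
        ((AffineCoordBlowup.𝓘Λ 4 K (insert 0 (Fin.succ '' (S' : Set (Fin 4))))).support : Set (P 4 K))))).boundary ∧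
      ∃ (Θ' : A 4 K ≃ₐ[K] A 4 K) (h' : MvPolynomial (Fin 4) K),
        Θ' (X 0) = X 0 + rename Fin.succ h' ∧ (∀ i : Fin 4, Θ' (X i.succ) = X i.succ + C (b' i)) ∧
        (M.transform π₂ (vanishingIdeal (closureImage φ
          ((AffineCoordBlowup.𝓘Λ 4 K (insert 0 (Fin.succ '' (S' : Set (Fin 4))))).support : Set (P 4 K))))).ideal.comap
          (Spec.map (CommRingCat.ofHom (Θ' : A 4 K →+* A 4 K)) ≫
            AffineCoordBlowup.chartImm (isBlowup_restrict_globalCentre φ _ hπ₂) (succ_mem_centreVars hj') ≫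
              (π₂ ⁻¹ᵁ φ.opensRange).ι) =
          hypSheaf p (CentreBlowup.step p S' j' b' s₁).F ∧
        ∀ S'' : Finset (Fin 4), S' ⊆ S'' →
          IsClosed ((Spec.map (CommRingCat.ofHom (Θ' : A 4 K →+* A 4 K)) ≫
              AffineCoordBlowup.chartImm (isBlowup_restrict_globalCentre φ _ hπ₂) (succ_mem_centreVars hj') ≫
                (π₂ ⁻¹ᵁ φ.opensRange).ι) ''
            (AffineCoordBlowup.CΛ 4 K (insert 0 (Fin.succ '' (S'' : Set (Fin 4)))) : Set (P 4 K))) ∧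
          ∀ D₂ ∈ (M.transform π₂ (vanishingIdeal (closureImage φ
              ((AffineCoordBlowup.𝓘Λ 4 K (insert 0 (Fin.succ '' (S' : Set (Fin 4))))).support : Set (P 4 K))))).boundary,
            (∃ i ∈ S'', D₂.comap (Spec.map (CommRingCat.ofHom (Θ' : A 4 K →+* A 4 K)) ≫
                AffineCoordBlowup.chartImm (isBlowup_restrict_globalCentre φ _ hπ₂) (succ_mem_centreVars hj') ≫
                  (π₂ ⁻¹ᵁ φ.opensRange).ι) = ofIdealTop (Ideal.span {coord 4 K i.succ})) ∨
            ((D₂.support : Set W₂) ∩ (Spec.map (CommRingCat.ofHom (Θ' : A 4 K →+* A 4 K)) ≫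
                AffineCoordBlowup.chartImm (isBlowup_restrict_globalCentre φ _ hπ₂) (succ_mem_centreVars hj') ≫
                  (π₂ ⁻¹ᵁ φ.opensRange).ι) ''
              (AffineCoordBlowup.CΛ 4 K (insert 0 (Fin.succ '' (S'' : Set (Fin 4)))) : Set (P 4 K)) = ∅) := by
  haveI : IsProper π₂ := hπ₂.isProper
  haveI : IsLocallyNoetherian W₂ := LocallyOfFiniteType.isLocallyNoetherian π₂
  -- the FC-1 input, derived from the shape
  have hEc := hasSNCWith_globalCentre_of_shape φ hT hE fun D hD => (hshape D hD).imp_left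
    fun ⟨i, _, hi⟩ => ⟨i, hi⟩
  obtain ⟨Θ', h', h0', hs', hc⟩ := transform_ideal_chart_of_chart φ M hmult s₁ hM hπ₂ hj' hbj' hperm'
  refine ⟨IsMultipleBlowup.blowup hσ _ π₂ hπ₂ (isRegular_globalCentre φ hT)
      (support_globalCentre_subset_support φ hT hmult hM hperm') hEc,
    MarkedIdeal.hasSNC_transform_boundary M hEc hπ₂, Θ', h', h0', hs', hc, fun S'' hsub => ⟨?_, ?_⟩⟩
  · exact isClosed_image_CΛ_chart_of_chart φ hT hπ₂ hj' hbj' h0' hs' hsub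
  · rw [MarkedIdeal.transform_boundary]
    exact shape_transform φ hT hπ₂ hj' hbj' hs' hsub hshape

end Monotone

/-! ## The base: depth one -/

section Start

variable {K : Type} [Field K] {p : ℕ} [Fact p.Prime] [CharP K p] [PerfectRing K p] [DecidableEq K]
  {S : Finset (Fin 4)} {j : Fin 4} {b : Fin 4 → K} {F : MvPolynomial (Fin 4) K} {W : Scheme.{0}} {π : W ⟶ P 4 K}

/-- **DEPTH ONE: the start of a monotone coordinate chain.** For `S` Hironaka-permissible for `z^p + F`, ANY blowing up
`π : W → 𝔸⁵_K` along `V(z, x_S)`, `j ∈ S` and `b_j = 0`: `π` is an admissible blow-up of `M₀ = (𝔸⁵, (z^p + F)·𝒪, [], p)`,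
the transformed boundary `[E]` has simple normal crossings, and on a re-centred chart `φ = Spec Θ ≫ chartImm` the
transform reads `(z^p + s₁.F)·𝒪`, `s₁ = CentreBlowup.step p S j b (F, 0, ∅)`; for EVERY `S₁ ⊇ S` the chart centre
`φ(V(z, x_{S₁}))` is closed in `W` and the boundary `[E]` has the SHAPE relative to `(φ, S₁)` (`E` reads `V(x_j)`,
`j ∈ S ⊆ S₁`) — INVARIANT(W, φ, M₁, s₁, S₁). -/
theorem monotone_chain_start (hS : IsPermissibleCentre p S F)
    (hπ : IsBlowup π (AffineCoordBlowup.𝓘Λ 4 K (insert 0 (Fin.succ '' (S : Set (Fin 4)))))) (hj : j ∈ S)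
    (hbj : b j = 0) :
    IsMultipleBlowup (⟨hypSheaf p F, [], p⟩ : MarkedIdeal (P 4 K)) π
        ((⟨hypSheaf p F, [], p⟩ : MarkedIdeal (P 4 K)).transform π
          (AffineCoordBlowup.𝓘Λ 4 K (insert 0 (Fin.succ '' (S : Set (Fin 4)))))) ∧
      HasSNC ((⟨hypSheaf p F, [], p⟩ : MarkedIdeal (P 4 K)).transform π
          (AffineCoordBlowup.𝓘Λ 4 K (insert 0 (Fin.succ '' (S : Set (Fin 4)))))).boundary ∧
      ∃ (Θ : A 4 K ≃ₐ[K] A 4 K) (h : MvPolynomial (Fin 4) K),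
        Θ (X 0) = X 0 + rename Fin.succ h ∧ (∀ i : Fin 4, Θ (X i.succ) = X i.succ + C (b i)) ∧
        (((⟨hypSheaf p F, [], p⟩ : MarkedIdeal (P 4 K)).transform π
            (AffineCoordBlowup.𝓘Λ 4 K (insert 0 (Fin.succ '' (S : Set (Fin 4)))))).ideal).comap
          (Spec.map (CommRingCat.ofHom (Θ : A 4 K →+* A 4 K)) ≫ AffineCoordBlowup.chartImm hπ (succ_mem_centreVars hj)) =
          hypSheaf p (CentreBlowup.step p S j b (⟨F, 0, ∅⟩ : State K)).F ∧
        ∀ S₁ : Finset (Fin 4), S ⊆ S₁ →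
          IsClosed ((Spec.map (CommRingCat.ofHom (Θ : A 4 K →+* A 4 K)) ≫
              AffineCoordBlowup.chartImm hπ (succ_mem_centreVars hj)) ''
            (AffineCoordBlowup.CΛ 4 K (insert 0 (Fin.succ '' (S₁ : Set (Fin 4)))) : Set (P 4 K))) ∧
          ∀ D ∈ ((⟨hypSheaf p F, [], p⟩ : MarkedIdeal (P 4 K)).transform π
              (AffineCoordBlowup.𝓘Λ 4 K (insert 0 (Fin.succ '' (S : Set (Fin 4)))))).boundary,
            (∃ i ∈ S₁, D.comap (Spec.map (CommRingCat.ofHom (Θ : A 4 K →+* A 4 K)) ≫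
                AffineCoordBlowup.chartImm hπ (succ_mem_centreVars hj)) = ofIdealTop (Ideal.span {coord 4 K i.succ})) ∨
            ((D.support : Set W) ∩ (Spec.map (CommRingCat.ofHom (Θ : A 4 K →+* A 4 K)) ≫
                AffineCoordBlowup.chartImm hπ (succ_mem_centreVars hj)) ''
              (AffineCoordBlowup.CΛ 4 K (insert 0 (Fin.succ '' (S₁ : Set (Fin 4)))) : Set (P 4 K)) = ∅) := by
  haveI : IsProper π := hπ.isProper
  haveI : IsLocallyNoetherian W := LocallyOfFiniteType.isLocallyNoetherian π
  obtain ⟨Θ, h, h0, hs, hI⟩ := transform_ideal_chart_eq_step p hj hbj (⟨F, 0, ∅⟩ : State K) hS.2 [] hπ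
  have hΘj : (Θ : A 4 K →+* A 4 K) (X j.succ) = X j.succ := by
    rw [show (Θ : A 4 K →+* A 4 K) (X j.succ) = Θ (X j.succ) from rfl, hs j, hbj, C_0, add_zero]
  refine ⟨isMultipleBlowup_single_of_isPermissibleCentre p hS hπ,
    MarkedIdeal.hasSNC_transform_boundary _ (hasSNCWith_nil_𝓘Λ _) hπ, Θ, h, h0, hs, hI, fun S₁ hsub => ⟨?_, ?_⟩⟩
  · exact isClosed_image_CΛ_chart hj hbj h0 hs hπ ((Finset.erase_subset j S).trans hsub)
  · intro D hD
    rw [MarkedIdeal.transform_boundary, List.map_nil, List.nil_append, List.mem_singleton] at hD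
    subst hD
    left
    exact ⟨j, hsub hj, comap_exceptional_chart hj hΘj hπ⟩

end Start

end ChartDictionary

end Summit.ResolutionOfSingularities.ResolutionOfSingularities.Theorems.PIDim4

end
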